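import Summits.HubbardSuperconductivity.HubbardSuperconductivity.Theorems.WidthHaldaneLeggettFloor

/-!
# Current rigidity: Kohn's formula as an inequality on every untwisted ground state

Crux `WidthHaldaneBridge` (stmt-HubbardSuperconductivity-16311), line `Sketch` = card
`twist-transfer-floors`, registered stub `stub_currentRigidity`. The stiffness clause of `UniformThermo`
is an OPERATOR inequality on the sector `(N, S^z = 0)`: in the uniform twist gauge
`W_θ (tubeH0 + tubeTwist θ) W_θᴴ = tubeH0 + T_θ` AS MATRICES (`gauged_tubeH_eq`, the operator form of
`WidthHaldaneTubeGauge.expect_gauged_tubeH`; `T_θ = Σ_{x∼y,σ} (1 - ω_θ(x,y))·c†_{xσ}c_{yσ}` the spread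
twist), hence `tubeH0 + T_θ ≥ E(θ) ≥ E₀ + c` as a quadratic form on the sector
(`c = d₀(π/3)²M/(2L)` under the stiffness floor). Tested on `ψ + ζ` with `ψ` a unit `θ = 0` ground
state (`H₀ψ = E₀ψ`) and `ζ ⊥ ψ` in the sector this reads

  `-2Re⟨ζ, Tψ⟩ - Re⟨ζ, (H₀ + T)ζ⟩ + (E₀ + c)‖ζ‖² ≤ Re⟨ψ, Tψ⟩ - c`

— Kohn's/Scalapino–White–Zhang's `D_s = ⟨-k_x⟩ - Λ_xx > 0` as a constraint ON `ψ`: the paramagnetic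
current weight of every sector ground state falls short of the diamagnetic one. PROVED here (no
definition, no named fact):

* `phaseGauge_conj_tubeTwist_op` — operator-level gauge conjugation of the seam twist;
* **`gauged_tubeH_eq`** — `W_θ (H₀ + Tw_θ) W_θᴴ = H₀ + T_θ` (`L ≥ 3`);
* (inline) a sector minimum bounds the quadratic form: `E_K(A)·‖v‖² ≤ Re⟨v, Av⟩` (the tree's
  `JosephsonMirror.minEnergyOn_mul_le_of_mem`, re-derived locally to keep the import closure small);
* `rigidity_core` — the polarisation algebra for `v = ψ + ζ`;
* **`currentRigidity_of_stiffness`**, `stub_currentRigidity` (the registered closed form).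

References: W. Kohn, Phys. Rev. 133 (1964) A171; D. J. Scalapino, S. R. White, S. C. Zhang, PRB 47
(1993) 7995, §II; A. Paramekanti, N. Trivedi, M. Randeria, PRB 57 (1998) 11639, §III.
-/

noncomputable section

namespace Summit.HubbardSuperconductivity.HubbardSuperconductivity.Theorems.WidthHaldane

set_option linter.dupNamespace false -- summit = problem name (single-conjunct summit), D-0017

open scoped BigOperators Classical Matrix ComplexConjugate
open Matrix Literature.MathematicalPhysics.QuantumLattice
open Summit.HubbardSuperconductivity.HubbardSuperconductivity.Theorems.DeformationLadder
  (phaseGauge_conj_hamiltonian)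

/-! ### Generic: sector minima bound quadratic forms; the polarisation algebra -/

section Generic

variable {n : Type*} [Fintype n] [DecidableEq n]

omit [DecidableEq n] in
/-- For a Hermitian matrix, `⟨x, A y⟩ = conj ⟨y, A x⟩`. [folklore] -/
theorem star_dotProduct_mulVec_comm {A : Matrix n n ℂ} (hA : A.IsHermitian) (x y : n → ℂ) :
    star x ⬝ᵥ A *ᵥ y = star (star y ⬝ᵥ A *ᵥ x) := by
  rw [star_dotProduct x (A *ᵥ y), star_mulVec, ← dotProduct_mulVec, hA.eq]

omit [DecidableEq n] in
/-- **The polarisation algebra of current rigidity.** Let `H` be Hermitian with `Hψ = E₀ψ`, `‖ψ‖ = 1`,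
let `H + T` be Hermitian and bounded below on `K ∋ ψ, ζ` by `E₀ + c` as a quadratic form, and let
`ζ ⊥ ψ`. Then `-2Re⟨ζ, Tψ⟩ - Re⟨ζ, (H + T)ζ⟩ + (E₀ + c)‖ζ‖² ≤ Re⟨ψ, Tψ⟩ - c` (test `ψ + ζ`).
[folklore] -/
theorem rigidity_core {H T : Matrix n n ℂ} (hHT : (H + T).IsHermitian)
    {K : Submodule ℂ (n → ℂ)} {E₀ c : ℝ}
    (hfloor : ∀ v ∈ K, (E₀ + c) * (star v ⬝ᵥ v).re ≤ (star v ⬝ᵥ (H + T) *ᵥ v).re)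
    {ψ ζ : n → ℂ} (h1 : star ψ ⬝ᵥ ψ = 1) (hψK : ψ ∈ K) (hHψ : H *ᵥ ψ = (E₀ : ℂ) • ψ)
    (hζK : ζ ∈ K) (hperp : star ζ ⬝ᵥ ψ = 0) :
    -(2 * (star ζ ⬝ᵥ (T *ᵥ ψ)).re) - (star ζ ⬝ᵥ ((H + T) *ᵥ ζ)).re + (E₀ + c) * (star ζ ⬝ᵥ ζ).re ≤
      (star ψ ⬝ᵥ (T *ᵥ ψ)).re - c := by
  have hv := hfloor (ψ + ζ) (K.add_mem hψK hζK)
  -- norms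
  have hperp' : star ψ ⬝ᵥ ζ = 0 := by rw [star_dotProduct ψ ζ, hperp, star_zero]
  have hnn : (star (ψ + ζ) ⬝ᵥ (ψ + ζ)).re = 1 + (star ζ ⬝ᵥ ζ).re := by
    rw [star_add, add_dotProduct, dotProduct_add, dotProduct_add, h1, hperp, hperp']
    simp
  -- the quadratic form
  have hTψζ : star ζ ⬝ᵥ (H + T) *ᵥ ψ = star ζ ⬝ᵥ (T *ᵥ ψ) := by
    rw [add_mulVec, dotProduct_add, hHψ, dotProduct_smul, hperp, smul_zero, zero_add]
  have hψHTζ : (star ψ ⬝ᵥ (H + T) *ᵥ ζ).re = (star ζ ⬝ᵥ (T *ᵥ ψ)).re := by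
    rw [star_dotProduct_mulVec_comm hHT, hTψζ, Complex.star_def, Complex.conj_re]
  have hψψ : (star ψ ⬝ᵥ (H + T) *ᵥ ψ).re = E₀ + (star ψ ⬝ᵥ (T *ᵥ ψ)).re := by
    rw [add_mulVec, dotProduct_add, hHψ, dotProduct_smul, h1, Complex.add_re]
    simp
  have hqq : (star (ψ + ζ) ⬝ᵥ (H + T) *ᵥ (ψ + ζ)).re =
      E₀ + (star ψ ⬝ᵥ (T *ᵥ ψ)).re + 2 * (star ζ ⬝ᵥ (T *ᵥ ψ)).re + (star ζ ⬝ᵥ (H + T) *ᵥ ζ).re := by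
    rw [star_add, add_dotProduct, mulVec_add, dotProduct_add, dotProduct_add, Complex.add_re, Complex.add_re,
      Complex.add_re, hψψ, hψHTζ, hTψζ]
    ring
  rw [hnn, hqq] at hv
  linarith

end Generic

/-! ### The operator form of the twist gauge -/

section Operator

variable (L M : ℕ) [NeZero L] [NeZero M] (Λ : Type) [LinearOrder Λ] [Fintype Λ]
  (e : Λ ≃ ZMod L × ZMod M)

/-- Operator-level gauge conjugation of the seam twist: every seam monomial picks up the gauge phases
(`phaseGauge_conj_hop`). [cite: KomaTasakiPRL1992, eqs. (7)–(8)] -/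
theorem phaseGauge_conj_tubeTwist_op (g : Λ → Circle) (θ : ℝ) :
    phaseGauge g * tubeTwist L M Λ e θ * (phaseGauge g)ᴴ =
      ∑ b : ZMod M, ∑ σ : Fin 2,
        (((1 - Complex.exp (Complex.I * θ)) * ((g (e.symm (0, b)) : ℂ) * conj (g (e.symm (-1, b)) : ℂ))) •
            (creation (orb (e.symm (0, b)) σ) * annihilation (orb (e.symm (-1, b)) σ)) +
          ((1 - Complex.exp (-(Complex.I * θ))) * ((g (e.symm (-1, b)) : ℂ) * conj (g (e.symm (0, b)) : ℂ))) •
            (creation (orb (e.symm (-1, b)) σ) * annihilation (orb (e.symm (0, b)) σ))) := by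
  unfold tubeTwist
  simp only [Finset.mul_sum, Finset.sum_mul, Matrix.mul_add, Matrix.add_mul, Matrix.mul_smul,
    Matrix.smul_mul, phaseGauge_conj_hop, smul_smul]

omit [NeZero L] [NeZero M] [LinearOrder Λ] [Fintype Λ] in
/-- Moving a two-term matrix sum through a guard. [folklore] -/
theorem ite_sum_fin_two_matrix (c : Prop) [Decidable c] (f : Fin 2 → Matrix (Finset (Orb Λ)) (Finset (Orb Λ)) ℂ) :
    (if c then ∑ σ : Fin 2, f σ else 0) = ∑ σ : Fin 2, if c then f σ else 0 := by
  split_ifs <;> simp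

omit [NeZero L] [NeZero M] [LinearOrder Λ] [Fintype Λ] in
/-- A guarded scalar multiple is a scalar-guarded multiple. [folklore] -/
theorem ite_smul_eq (c : Prop) [Decidable c] (s : ℂ) (A : Matrix (Finset (Orb Λ)) (Finset (Orb Λ)) ℂ) :
    (if c then s • A else 0) = (if c then s else 0) • A := by
  split_ifs <;> simp

/-- **THE OPERATOR IDENTITY OF THE TWIST GAUGE** (`L ≥ 3`): for the twist gauge `g_z = e^{iθ z₁/L}`,
`W_g (H₀ + Tw_θ) W_gᴴ = H₀ + T_θ` with the spread twist
`T_θ = Σ_{x∼y,σ} (1 - ω_θ(x,y))·c†_{xσ}c_{yσ}` (uniform Peierls weights `e^{± iθ/L}` longitudinally, `1`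
transversally) — the operator form of `expect_gauged_tubeH`. [cite: Watanabe2019, §2.2.3 and §4.1] -/
theorem gauged_tubeH_eq (hL : 3 ≤ L) (U θ : ℝ) :
    (phaseGauge (fun z : Λ => Circle.exp (θ / L * ((e z).1.val : ℝ)))) * (tubeH0 L M Λ e U + tubeTwist L M Λ e θ) * (phaseGauge (fun z : Λ => Circle.exp (θ / L * ((e z).1.val : ℝ))))ᴴ = tubeH0 L M Λ e U + (∑ x : Λ, ∑ y : Λ, ∑ σ : Fin 2, (if (tubeGraph e).Adj x y then (1 - (if (e x).1 = (e y).1 + 1 ∧ (e x).2 = (e y).2 then Complex.exp (((θ / L : ℝ) : ℂ) * Complex.I) else if (e y).1 = (e x).1 + 1 ∧ (e x).2 = (e y).2 then Complex.exp (-(((θ / L : ℝ) : ℂ) * Complex.I)) else 1)) • (creation (orb x σ) * annihilation (orb y σ)) else 0)) := by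
  -- write the untwisted tube on the right in the same gauged shape, with the trivial gauge
  have htriv : tubeH0 L M Λ e U =
      phaseGauge (1 : Λ → Circle) * hamiltonian (tubeGraph e) 1 U * (phaseGauge (1 : Λ → Circle))ᴴ := by
    rw [phaseGauge_one, Matrix.one_mul, conjTranspose_one, Matrix.mul_one, tubeH0_eq]
  conv_rhs => rw [htriv, phaseGauge_conj_hamiltonian]
  rw [Matrix.mul_add, Matrix.add_mul, tubeH0_eq, phaseGauge_conj_hamiltonian, phaseGauge_conj_tubeTwist_op]
  simp only [Finset.sum_add_distrib]
  -- the two seam sums as double sums over ordered pairs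
  rw [sum_seam_eq_sum_sum L M Λ e (fun x y => ∑ σ : Fin 2,
      ((1 - Complex.exp (Complex.I * θ)) *
        ((Circle.exp (θ / L * ((e x).1.val : ℝ)) : ℂ) * conj (Circle.exp (θ / L * ((e y).1.val : ℝ)) : ℂ))) •
          (creation (orb x σ) * annihilation (orb y σ))),
    sum_seam_eq_sum_sum' L M Λ e (fun x y => ∑ σ : Fin 2,
      ((1 - Complex.exp (-(Complex.I * θ))) *
        ((Circle.exp (θ / L * ((e x).1.val : ℝ)) : ℂ) * conj (Circle.exp (θ / L * ((e y).1.val : ℝ)) : ℂ))) •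
          (creation (orb x σ) * annihilation (orb y σ)))]
  simp only [ite_sum_fin_two_matrix]
  -- everything under one triple sum
  rw [Complex.ofReal_one, neg_smul, one_smul, neg_smul, one_smul]
  conv_lhs => rw [add_assoc, add_comm ((U : ℂ) • _), ← add_assoc]
  conv_rhs => rw [add_right_comm]
  rw [add_left_inj]
  simp only [← Finset.sum_neg_distrib, ← Finset.sum_add_distrib]
  refine Finset.sum_congr rfl fun x _ => Finset.sum_congr rfl fun y _ => Finset.sum_congr rfl fun σ _ => ?_
  have key := gauge_pointwise L M Λ e hL θ x y
  simp only [ite_smul_eq]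
  simp only [← neg_smul, ← add_smul]
  congr 1
  simp only [Pi.one_apply, Circle.coe_one, map_one, mul_one]
  split_ifs at key ⊢ <;> linear_combination key

end Operator

/-! ### Current rigidity on the tubes -/

section Rigidity

variable (L M : ℕ) [NeZero L] [NeZero M] (Λ : Type) [LinearOrder Λ] [Fintype Λ]
  (e : Λ ≃ ZMod L × ZMod M)

/-- **CURRENT RIGIDITY from a stiffness floor** (`L ≥ 3`): if `d₀ ≤ ρ̃_{L,M}(U,δ)`, then for every
normalised `(N_{L,M}(δ), S^z = 0)` ground state `ψ` of the pure tube and every `ζ ⊥ ψ` in the sector,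
`-2Re⟨ζ, Tψ⟩ - Re⟨ζ, (H₀ + T)ζ⟩ + (E₀ + c)‖ζ‖² ≤ Re⟨ψ, Tψ⟩ - c`, `T = T_{π/3}` the spread twist,
`c = d₀(π/3)²M/(2L)`, `E₀ = E(0)`. Scalapino–White–Zhang, PRB 47 (1993) 7995, §II; Kohn, Phys. Rev.
133 (1964) A171. [cite: ScalapinoWhiteZhang1993, §II] -/
theorem currentRigidity_of_stiffness (hL : 3 ≤ L) (U : ℝ) {δ d₀ : ℝ} (hd : d₀ ≤ tubeStiffness L M Λ e U δ)
    {ψ ζ : Fock (Orb Λ)} (h1 : star ψ ⬝ᵥ ψ = 1)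
    (hgs : IsGroundStateInSector (tubeH0 L M Λ e U) (tubeFilling L M δ) 0 ψ)
    (hζ : ζ ∈ szSector (tubeFilling L M δ) (0 : ℝ)) (hperp : star ζ ⬝ᵥ ψ = 0) :
    -(2 * (star ζ ⬝ᵥ ((∑ x : Λ, ∑ y : Λ, ∑ σ : Fin 2, (if (tubeGraph e).Adj x y then (1 - (if (e x).1 = (e y).1 + 1 ∧ (e x).2 = (e y).2 then Complex.exp (((Real.pi / 3 / L : ℝ) : ℂ) * Complex.I) else if (e y).1 = (e x).1 + 1 ∧ (e x).2 = (e y).2 then Complex.exp (-(((Real.pi / 3 / L : ℝ) : ℂ) * Complex.I)) else 1)) • (creation (orb x σ) * annihilation (orb y σ)) else 0)) *ᵥ ψ)).re) - (star ζ ⬝ᵥ ((tubeH0 L M Λ e U + (∑ x : Λ, ∑ y : Λ, ∑ σ : Fin 2, (if (tubeGraph e).Adj x y then (1 - (if (e x).1 = (e y).1 + 1 ∧ (e x).2 = (e y).2 then Complex.exp (((Real.pi / 3 / L : ℝ) : ℂ) * Complex.I) else if (e y).1 = (e x).1 + 1 ∧ (e x).2 = (e y).2 then Complex.exp (-(((Real.pi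 / 3 / L : ℝ) : ℂ) * Complex.I)) else 1)) • (creation (orb x σ) * annihilation (orb y σ)) else 0))) *ᵥ ζ)).re +
        (tubeEnergy L M Λ e U 0 (tubeFilling L M δ) + d₀ * (Real.pi / 3) ^ 2 * (M : ℝ) / (2 * (L : ℝ))) *
          (star ζ ⬝ᵥ ζ).re ≤
      (expect (∑ x : Λ, ∑ y : Λ, ∑ σ : Fin 2, (if (tubeGraph e).Adj x y then (1 - (if (e x).1 = (e y).1 + 1 ∧ (e x).2 = (e y).2 then Complex.exp (((Real.pi / 3 / L : ℝ) : ℂ) * Complex.I) else if (e y).1 = (e x).1 + 1 ∧ (e x).2 = (e y).2 then Complex.exp (-(((Real.pi / 3 / L : ℝ) : ℂ) * Complex.I)) else 1)) • (creation (orb x σ) * annihilation (orb y σ)) else 0)) ψ).re - d₀ * (Real.pi / 3) ^ 2 * (M : ℝ) / (2 * (L : ℝ)) := by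
  have hop := gauged_tubeH_eq L M Λ e hL U (Real.pi / 3)
  -- the gauged tube is Hermitian and has sector minimum `E(π/3)`
  have hHT : (tubeH0 L M Λ e U + (∑ x : Λ, ∑ y : Λ, ∑ σ : Fin 2, (if (tubeGraph e).Adj x y then (1 - (if (e x).1 = (e y).1 + 1 ∧ (e x).2 = (e y).2 then Complex.exp (((Real.pi / 3 / L : ℝ) : ℂ) * Complex.I) else if (e y).1 = (e x).1 + 1 ∧ (e x).2 = (e y).2 then Complex.exp (-(((Real.pi / 3 / L : ℝ) : ℂ) * Complex.I)) else 1)) • (creation (orb x σ) * annihilation (orb y σ)) else 0))).IsHermitian := by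
    rw [← hop]
    exact Matrix.isHermitian_mul_mul_conjTranspose _ (isHermitian_tubeH L M Λ e U (Real.pi / 3))
  have hmin : (tubeH0 L M Λ e U + (∑ x : Λ, ∑ y : Λ, ∑ σ : Fin 2, (if (tubeGraph e).Adj x y then (1 - (if (e x).1 = (e y).1 + 1 ∧ (e x).2 = (e y).2 then Complex.exp (((Real.pi / 3 / L : ℝ) : ℂ) * Complex.I) else if (e y).1 = (e x).1 + 1 ∧ (e x).2 = (e y).2 then Complex.exp (-(((Real.pi / 3 / L : ℝ) : ℂ) * Complex.I)) else 1)) • (creation (orb x σ) * annihilation (orb y σ)) else 0))).minEnergyOn (szSector (tubeFilling L M δ) 0) =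
      tubeEnergy L M Λ e U (Real.pi / 3) (tubeFilling L M δ) := by
    have hunit := minEnergyOn_szSector_phaseGauge_conj
      (fun z : Λ => Circle.exp (Real.pi / 3 / L * ((e z).1.val : ℝ)))⁻¹
      (tubeH0 L M Λ e U + tubeTwist L M Λ e (Real.pi / 3)) (tubeFilling L M δ) 0
    rw [phaseGauge_conjTranspose, inv_inv, ← phaseGauge_conjTranspose, hop] at hunit
    rw [hunit, tubeEnergy_eq]
  -- the energy floor from the stiffness floor
  have hfl := energyFloor_of_stiffness L M Λ e hd
  have hE0 : tubeEnergy L M Λ e U 0 (tubeFilling L M δ) =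
      (tubeH0 L M Λ e U).minEnergyOn (szSector (tubeFilling L M δ) 0) := tubeEnergy_zero L M Λ e U _
  have hc : d₀ * (Real.pi / 3) ^ 2 * (M : ℝ) / (2 * (L : ℝ)) = d₀ * ((Real.pi / 3) ^ 2 * (M : ℝ)) / (2 * L) := by
    ring
  -- the quadratic-form floor on the sector
  have hfloor : ∀ v ∈ szSector (tubeFilling L M δ) (0 : ℝ),
      ((tubeH0 L M Λ e U).minEnergyOn (szSector (tubeFilling L M δ) 0) +
          d₀ * (Real.pi / 3) ^ 2 * (M : ℝ) / (2 * (L : ℝ))) * (star v ⬝ᵥ v).re ≤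
        (star v ⬝ᵥ (tubeH0 L M Λ e U + (∑ x : Λ, ∑ y : Λ, ∑ σ : Fin 2, (if (tubeGraph e).Adj x y then (1 - (if (e x).1 = (e y).1 + 1 ∧ (e x).2 = (e y).2 then Complex.exp (((Real.pi / 3 / L : ℝ) : ℂ) * Complex.I) else if (e y).1 = (e x).1 + 1 ∧ (e x).2 = (e y).2 then Complex.exp (-(((Real.pi / 3 / L : ℝ) : ℂ) * Complex.I)) else 1)) • (creation (orb x σ) * annihilation (orb y σ)) else 0))) *ᵥ v).re := by
    intro v hv
    -- the sector variational principle without normalisation (cf. `JosephsonMirror.minEnergyOn_mul_le_of_mem`)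
    have hq : tubeEnergy L M Λ e U (Real.pi / 3) (tubeFilling L M δ) * (star v ⬝ᵥ v).re ≤
        (star v ⬝ᵥ (tubeH0 L M Λ e U + (∑ x : Λ, ∑ y : Λ, ∑ σ : Fin 2, (if (tubeGraph e).Adj x y then (1 - (if (e x).1 = (e y).1 + 1 ∧ (e x).2 = (e y).2 then Complex.exp (((Real.pi / 3 / L : ℝ) : ℂ) * Complex.I) else if (e y).1 = (e x).1 + 1 ∧ (e x).2 = (e y).2 then Complex.exp (-(((Real.pi / 3 / L : ℝ) : ℂ) * Complex.I)) else 1)) • (creation (orb x σ) * annihilation (orb y σ)) else 0))) *ᵥ v).re := by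
      rw [← hmin]
      by_cases h0 : v = 0
      · simp [h0]
      obtain ⟨c, hc0, hc1⟩ := exists_smul_unit h0
      have h := minEnergyOn_le_rayleigh_of_mem hHT _ (Submodule.smul_mem _ c hv) hc1
      have hcc : (starRingEnd ℂ) c * c = ((Complex.normSq c : ℝ) : ℂ) := by
        rw [Complex.normSq_eq_conj_mul_self]
      rw [star_smul, smul_dotProduct, mulVec_smul, dotProduct_smul, smul_smul, Complex.star_def, hcc,
        smul_eq_mul, Complex.re_ofReal_mul] at h
      have hnorm : Complex.normSq c * (star v ⬝ᵥ v).re = 1 := by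
        have h2 := congr_arg Complex.re hc1
        rw [star_smul, smul_dotProduct, dotProduct_smul, smul_smul, Complex.star_def, hcc, smul_eq_mul,
          Complex.re_ofReal_mul, Complex.one_re] at h2
        exact h2
      have hpos : 0 ≤ (star v ⬝ᵥ v).re := by
        rw [← eucNorm_sq]
        positivity
      calc _ ≤ Complex.normSq c * (star v ⬝ᵥ (tubeH0 L M Λ e U + (∑ x : Λ, ∑ y : Λ, ∑ σ : Fin 2, (if (tubeGraph e).Adj x y then (1 - (if (e x).1 = (e y).1 + 1 ∧ (e x).2 = (e y).2 then Complex.exp (((Real.pi / 3 / L : ℝ) : ℂ) * Complex.I) else if (e y).1 = (e x).1 + 1 ∧ (e x).2 = (e y).2 then Complex.exp (-(((Real.pi / 3 / L : ℝ) : ℂ) * Complex.I)) else 1)) • (creation (orb x σ) * annihilation (orb y σ)) else 0))) *ᵥ v).re * (star v ⬝ᵥ v).re :=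
            mul_le_mul_of_nonneg_right h hpos
        _ = (star v ⬝ᵥ (tubeH0 L M Λ e U + (∑ x : Λ, ∑ y : Λ, ∑ σ : Fin 2, (if (tubeGraph e).Adj x y then (1 - (if (e x).1 = (e y).1 + 1 ∧ (e x).2 = (e y).2 then Complex.exp (((Real.pi / 3 / L : ℝ) : ℂ) * Complex.I) else if (e y).1 = (e x).1 + 1 ∧ (e x).2 = (e y).2 then Complex.exp (-(((Real.pi / 3 / L : ℝ) : ℂ) * Complex.I)) else 1)) • (creation (orb x σ) * annihilation (orb y σ)) else 0))) *ᵥ v).re * (Complex.normSq c * (star v ⬝ᵥ v).re) := by ring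
        _ = _ := by rw [hnorm, mul_one]
    have hpos : 0 ≤ (star v ⬝ᵥ v).re := by
      rw [← eucNorm_sq]
      positivity
    have hle : (tubeH0 L M Λ e U).minEnergyOn (szSector (tubeFilling L M δ) 0) +
        d₀ * (Real.pi / 3) ^ 2 * (M : ℝ) / (2 * (L : ℝ)) ≤
          tubeEnergy L M Λ e U (Real.pi / 3) (tubeFilling L M δ) := by
      rw [hc, ← hE0]
      linarith
    exact (mul_le_mul_of_nonneg_right hle hpos).trans hq
  rw [hE0]
  exact rigidity_core hHT hfloor h1 hgs.1 hgs.2.2 hζ hperp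

end Rigidity

/-- **`stub_currentRigidity`** (registered stub of crux stmt-HubbardSuperconductivity-16311, line `Sketch`
/ card `twist-transfer-floors`): under `UniformThermo` with `d₀ > 0`, at every admissible size and
labelling, every normalised sector ground state `ψ` of the untwisted tube and every `ζ ⊥ ψ` in the
sector obey the current-rigidity inequality. [cite: ScalapinoWhiteZhang1993, §II] -/
theorem stub_currentRigidity : ∀ (U δ d₀ k₀ : ℝ) (M₁ L₀ : ℕ), 0 < d₀ → UniformThermo U δ d₀ k₀ M₁ L₀ → ∀ (L M : ℕ) [NeZero L] [NeZero M], Even L → Even M → M₁ ≤ M → M ≤ L → L₀ ≤ L → 3 ≤ L → ∀ (Λ : Type) [LinearOrder Λ] [Fintype Λ] (e : Λ ≃ ZMod L × ZMod M) (ψ ζ : Fock (Orb Λ)), star ψ ⬝ᵥ ψ = 1 → IsGroundStateInSector (tubeH0 L M Λ e U) (tubeFilling L M δ) 0 ψ → ζ ∈ szSector (tubeFilling L M δ) (0 : ℝ) → star ζ ⬝ᵥ ψ = 0 → -(2 * (star ζ ⬝ᵥ ((∑ x : Λ, ∑ y : Λ, ∑ σ : Fin 2, (if (tubeGraph e).Adj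 x y then (1 - (if (e x).1 = (e y).1 + 1 ∧ (e x).2 = (e y).2 then Complex.exp (((Real.pi / 3 / L : ℝ) : ℂ) * Complex.I) else if (e y).1 = (e x).1 + 1 ∧ (e x).2 = (e y).2 then Complex.exp (-(((Real.pi / 3 / L : ℝ) : ℂ) * Complex.I)) else 1)) • (creation (orb x σ) * annihilation (orb y σ)) else 0)) *ᵥ ψ)).re) - (star ζ ⬝ᵥ ((tubeH0 L M Λ e U + ∑ x : Λ, ∑ y : Λ, ∑ σ : Fin 2, (if (tubeGraph e).Adj x y then (1 - (if (e x).1 = (e y).1 + 1 ∧ (e x).2 = (e y).2 then Complex.exp (((Real.pi / 3 / L : ℝ) : ℂ) * Complex.I) else if (e y).1 = (e x).1 + 1 ∧ (e x).2 = (e y).2 then Complex.exp (-(((Real.pi / 3 / L : ℝ) : ℂ) * Complex.I)) else 1)) • (creation (orb x σ) * annihilation (orb y σ)) else 0)) *ᵥ ζ)).re + (tubeEnergy L M Λ e U 0 (tubeFilling L M δ) + d₀ * (Real.pi / 3) ^ 2 * (M : ℝ) / (2 * (L : ℝ))) * (star ζ ⬝ᵥ ζ).re ≤ (expect (∑ x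 : Λ, ∑ y : Λ, ∑ σ : Fin 2, (if (tubeGraph e).Adj x y then (1 - (if (e x).1 = (e y).1 + 1 ∧ (e x).2 = (e y).2 then Complex.exp (((Real.pi / 3 / L : ℝ) : ℂ) * Complex.I) else if (e y).1 = (e x).1 + 1 ∧ (e x).2 = (e y).2 then Complex.exp (-(((Real.pi / 3 / L : ℝ) : ℂ) * Complex.I)) else 1)) • (creation (orb x σ) * annihilation (orb y σ)) else 0)) ψ).re - d₀ * (Real.pi / 3) ^ 2 * (M : ℝ) / (2 * (L : ℝ)) :=
  fun U _δ _d₀ _k₀ _M₁ _L₀ _hd₀ h L M _ _ hLe hMe hM₁ hML hL₀ hL Λ _ _ e _ψ _ζ h1 hgs hζ hperp =>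
    currentRigidity_of_stiffness L M Λ e hL U (h L M hLe hMe hM₁ hML hL₀ Λ e).1 h1 hgs hζ hperp

end Summit.HubbardSuperconductivity.HubbardSuperconductivity.Theorems.WidthHaldane

end
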